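import Summits.QuantumFields.YangMills.Theorems.BalabanUVNodesN12FlatRightInverseLetterFloorWeighted

/-!
# BalabanUVNodes ∕ N12 — (J-b) DEFINITIONS: print's η-unit size `q_η` on the enumerated rows of a determining set (the currency of dag-n12-c g18's LANE WORD «LOCATED-RHO ⇒ exit (b)»),
# so that the (χ) chart letter of dag-n12-w5 (`B15Prop1NearFlatPackageFromLetters`) and the (δ₂)∕right-inverse letters can pin `q := qEta 𝔹 k` BY NAME

Cell `pub-ymgap` (HUMAN RULINGS D-0062 ∕ D-0149), width seat `pub-ymgap-dag-n10-w1` g4.  `--kind definition --supports stmt-QuantumFields-27364 --as helper` (K1⁹, KEY MAP v2); count-neutral.  Precedent: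
the route's topic Defs files (`…K1V6Defs`, `…K0V19Defs`, `…N11FluctTruncationDefs`).  Modules H4 ∕ H4b of this lineage (`…N12FlatRightInverseLetterFloor[Weighted]`, p625544 ∕ the H4b pid) state the
letter floor with `q_η` spelled as a lambda; this file NAMES it and restates the floor by name.

THE OBJECT.  For a determining set `𝔹`, a top level `k` and a datum `v : Fin (constrCard 𝔹 k) → 𝔰𝔲(N)` on the enumerated rows (`constrEnum 𝔹 k`, level of the `i`-th row
`j_i := ((constrEnum 𝔹 k).symm i).1`): `levelWeight P j := ((L^d)∕(L²))^j` and `qEta 𝔹 k v := √(Σ_i levelWeight P j_i · ‖v i‖²)` (‖·‖ = the pinned Hilbert–Schmidt norm (17) of `𝔰𝔲(N)`).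
WHY THESE WEIGHTS ([Balaban1989LargeFieldII] (17)–(19) pp.360–361 «norms with the powers of η», read for the linearised constraint; LOCATED-RHO-2, INBOX l.≈36157): a unit level-`j` datum
costs `≍ L^{(d−2)j∕2}` in the bond-`ℓ²` (operator) seminorm for the minimal-norm right inverse and at least `L^{(d−2)j∕2}∕(4√N)` for any (module H4) — so in `qEta`-units the right-inverse letter
`p(Rf v) ≤ ρ·qEta 𝔹 k v` has the k-UNIFORM floor `ρ ≥ 1∕(4√N)` and CAN be `O(1)` (for the optimal inverse; the O(1) upper letter is print's (46)-class estimate and is NOT claimed anywhere in the tree).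

CONTENTS.  §1 `levelWeight`, `levelWeight_pos`, `levelWeight_eq_pow` (`= L^{(d−2)j}` for `2 ≤ d`), `qEta`, `qEta_def`, `qEta_nonneg`, `qEta_sq`, `norm_sq_le_qEta_sq` (each row is
dominated: `levelWeight j_i·‖v i‖² ≤ qEta²`).  §2 ★★★ `letter_floor_fderiv_msChart_one_Bj_qEta` ∕ `…_qEta_numeral` (H4b's η-floor BY NAME: `‖↑E‖²_op ≤ 16ρ²‖E‖²_HS`, `1 ≤ 16Nρ²`).

HONEST FRAMING.  Two definitions (a weight and a weighted `ℓ²` size) + bookkeeping + H4b by name; nothing of Bałaban's asserted; N12 NOT discharged; K1⁹ NOT closed; count-neutral (typed 28∕28 ·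
discharged 5∕27 unmoved); one finite 𝕋⁴ programme at fixed ε — R4 closes the conditional finite-𝕋⁴ rung `BalabanLadder.UV` only; the YM mass gap (Clay) is NOT proved by any of this.
No `sorry`, no `instance`, no `notation`; standard axioms.
-/

noncomputable section
open scoped BigOperators Matrix.Norms.L2Operator
open Finset
namespace Summit.QuantumFields.YangMills.BalabanUVNodes.N12EtaSizeDefs

open Literature.MathematicalPhysics.QuantumFieldTheory.Balaban1983to89
open T4Continuum (T4Family)
open T4AdjointCovarianceUnitary (lieSU)
open B15DeterminingSets
open B14.Eq213DetSet (Bj maxDomT)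
open Node00
open Summit.QuantumFields.YangMills.BalabanUVNodes.N12FlatRightInverseLetterFloorWeighted (letter_floor_fderiv_msChart_one_Bj_eta letter_floor_fderiv_msChart_one_Bj_eta_numeral)

/-! ## §1  The level weight and the η-unit size -/

section Defs

variable {P : Params} {N : ℕ}

variable (P) in
/-- **The level weight of print's η-units for the linearised constraint**: `levelWeight P j = ((L^d)∕(L²))^j` (`= L^{(d−2)j}`) — the square of the minimal bond-`ℓ²` cost order of a unit level-`j`
datum (module H4 `norm_sq_bondAvgIter_mul_le` is the exchange rate). [cite: Balaban1989LargeFieldII, (17)-(19) pp.360-361; Balaban1985Variational, (44)-(46) p.285] -/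
def levelWeight (j : ℕ) : ℝ := (((P.L : ℝ) ^ P.d) / ((P.L : ℝ) ^ 2)) ^ j

/-- `levelWeight P j > 0`. [cite: Balaban1989LargeFieldII, (17)-(19) pp.360-361 (bookkeeping)] -/
theorem levelWeight_pos (j : ℕ) : 0 < levelWeight P j := by
  have hL : (0 : ℝ) < (P.L : ℝ) := Nat.cast_pos.mpr P.L_pos
  unfold levelWeight
  positivity

/-- `levelWeight P j = L^{(d−2)·j}` when `2 ≤ d`. [cite: Balaban1989LargeFieldII, (17)-(19) pp.360-361 (bookkeeping)] -/
theorem levelWeight_eq_pow (hd : 2 ≤ P.d) (j : ℕ) : levelWeight P j = (P.L : ℝ) ^ ((P.d - 2) * j) := by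
  have hL : (P.L : ℝ) ≠ 0 := Nat.cast_ne_zero.mpr P.L_pos.ne'
  unfold levelWeight
  rw [pow_mul, pow_sub₀ _ hL hd, div_eq_mul_inv]

/-- **Print's η-unit size on the enumerated rows**: `qEta 𝔹 k v = √(Σ_i levelWeight P j_i · ‖v i‖²)`, `j_i = ((constrEnum 𝔹 k).symm i).1`, `‖·‖` the Hilbert–Schmidt norm (17) of `𝔰𝔲(N)` — the
`q` of J-C's package (N) in exit (b)'s currency. [cite: Balaban1989LargeFieldII, (17)-(19) pp.360-361; Balaban1988Convergent, (2.10)-(2.12) p.256] -/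
def qEta (𝔹 : DetSet P) (k : ℕ) (v : Fin (constrCard 𝔹 k) → lieSU (Fin N)) : ℝ :=
  Real.sqrt (∑ i, levelWeight P (((constrEnum 𝔹 k).symm i).1 : ℕ) * ‖v i‖ ^ 2)

/-- `qEta` unfolded to the lambda modules H4b ∕ (χ) spell. [cite: Balaban1989LargeFieldII, (17)-(19) pp.360-361 (bookkeeping)] -/
theorem qEta_def (𝔹 : DetSet P) (k : ℕ) (v : Fin (constrCard 𝔹 k) → lieSU (Fin N)) :
    qEta 𝔹 k v = Real.sqrt (∑ i, (((P.L : ℝ) ^ P.d) / ((P.L : ℝ) ^ 2)) ^ (((constrEnum 𝔹 k).symm i).1 : ℕ) * ‖v i‖ ^ 2) := rfl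

/-- `0 ≤ qEta`. [cite: Balaban1989LargeFieldII, (17)-(19) pp.360-361 (bookkeeping)] -/
theorem qEta_nonneg (𝔹 : DetSet P) (k : ℕ) (v : Fin (constrCard 𝔹 k) → lieSU (Fin N)) : 0 ≤ qEta 𝔹 k v := Real.sqrt_nonneg _

/-- `qEta² = Σ_i levelWeight j_i · ‖v i‖²`. [cite: Balaban1989LargeFieldII, (17)-(19) pp.360-361 (bookkeeping)] -/
theorem qEta_sq (𝔹 : DetSet P) (k : ℕ) (v : Fin (constrCard 𝔹 k) → lieSU (Fin N)) :
    qEta 𝔹 k v ^ 2 = ∑ i, levelWeight P (((constrEnum 𝔹 k).symm i).1 : ℕ) * ‖v i‖ ^ 2 :=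
  Real.sq_sqrt (Finset.sum_nonneg fun _ _ => mul_nonneg (levelWeight_pos _).le (sq_nonneg _))

/-- Each weighted row is dominated by `qEta²`. [cite: Balaban1989LargeFieldII, (17)-(19) pp.360-361 (bookkeeping)] -/
theorem levelWeight_mul_norm_sq_le_qEta_sq (𝔹 : DetSet P) (k : ℕ) (v : Fin (constrCard 𝔹 k) → lieSU (Fin N)) (i : Fin (constrCard 𝔹 k)) :
    levelWeight P (((constrEnum 𝔹 k).symm i).1 : ℕ) * ‖v i‖ ^ 2 ≤ qEta 𝔹 k v ^ 2 := by
  rw [qEta_sq]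
  exact Finset.single_le_sum (f := fun i => levelWeight P (((constrEnum 𝔹 k).symm i).1 : ℕ) * ‖v i‖ ^ 2)
    (fun i _ => mul_nonneg (levelWeight_pos _).le (sq_nonneg _)) (Finset.mem_univ i)

end Defs

/-! ## §2  Module H4b's η-floor by name -/

section Floor

variable {F : T4Family} {N : ℕ} [NeZero N] {K : ℕ}

/-- ★★★ **THE LETTER FLOOR IN `qEta`-UNITS AT `𝐁_k(Z)`**: every right inverse `Rf` of J-C's flat `Lf := fderiv ℝ (msChart F N K k (Bj M₁ Z k) (M˙1) 1) 0` with `p(Rf v) ≤ ρ·qEta (Bj M₁ Z k) k v` (`p ≥`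
bond-`ℓ²`) satisfies `‖↑E‖²_op ≤ 16·ρ²·‖E‖²_HS` for every `E ∈ 𝔰𝔲(N)`, given a unit square `x, x+e_μ, x+e_ν` of `k`-sites with centres in `maxDomT M₁ Z k` (`μ ≠ ν`, `x+e_ν ≠ x`, `k ≤ m+K`) —
H4b `letter_floor_fderiv_msChart_one_Bj_eta` by name. [cite: Balaban1989LargeFieldII, (17)-(19) pp.360-361; Balaban1985Variational, (44)-(48) p.285; Balaban1988Convergent, (2.13) pp.256-257] -/
theorem letter_floor_fderiv_msChart_one_Bj_qEta {k M₁ : ℕ} {Z : Set (Site (F.P K) 0)} (hk : k ≤ (F.P K).m + (F.P K).K) (x : Site (F.P K) k) {μ ν : Fin (F.P K).d}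
    (hμν : μ ≠ ν) (hx : x.shift ν ≠ x) (h₀ : embIter k x ∈ maxDomT M₁ Z k) (hμ : embIter k (x.shift μ) ∈ maxDomT M₁ Z k) (hν : embIter k (x.shift ν) ∈ maxDomT M₁ Z k)
    (p : Seminorm ℝ (PBond (F.P K) 0 → lieSU (Fin N))) (hp : ∀ Y : PBond (F.P K) 0 → lieSU (Fin N), ∑ b, ‖(Y b : Matrix (Fin N) (Fin N) ℂ)‖ ^ 2 ≤ p Y ^ 2)
    (Rf : (Fin (constrCard (Bj M₁ Z k : DetSet (F.P K)) k) → lieSU (Fin N)) → PBond (F.P K) 0 → lieSU (Fin N))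
    (hRf : ∀ v, fderiv ℝ (msChart F N K k (Bj M₁ Z k) (avgFamily (avOfRecord F N K) (1 : GaugeField (F.P K) 0 (SU N))) (1 : GaugeField (F.P K) 0 (SU N))) 0 (Rf v) = v)
    {ρ : ℝ} (hρ : ∀ v, p (Rf v) ≤ ρ * qEta (Bj M₁ Z k) k v) (E : lieSU (Fin N)) :
    ‖(E : Matrix (Fin N) (Fin N) ℂ)‖ ^ 2 ≤ 16 * ρ ^ 2 * ‖E‖ ^ 2 :=
  letter_floor_fderiv_msChart_one_Bj_eta hk x hμν hx h₀ hμ hν p hp Rf hRf hρ E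

/-- ★★★ **…AS A NUMBER**: with one non-zero `E ∈ 𝔰𝔲(N)`: `1 ≤ 16·N·ρ²` (`ρ ≥ 1∕(4√N)`), uniformly in `k`, the volume and the construction.
[cite: Balaban1989LargeFieldII, (17)-(19) pp.360-361; Balaban1985Variational, (44)-(48) p.285; Balaban1985Averaging, (17)-(19) p.21] -/
theorem letter_floor_fderiv_msChart_one_Bj_qEta_numeral {k M₁ : ℕ} {Z : Set (Site (F.P K) 0)} (hk : k ≤ (F.P K).m + (F.P K).K) (x : Site (F.P K) k) {μ ν : Fin (F.P K).d}
    (hμν : μ ≠ ν) (hx : x.shift ν ≠ x) (h₀ : embIter k x ∈ maxDomT M₁ Z k) (hμ : embIter k (x.shift μ) ∈ maxDomT M₁ Z k) (hν : embIter k (x.shift ν) ∈ maxDomT M₁ Z k)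
    (p : Seminorm ℝ (PBond (F.P K) 0 → lieSU (Fin N))) (hp : ∀ Y : PBond (F.P K) 0 → lieSU (Fin N), ∑ b, ‖(Y b : Matrix (Fin N) (Fin N) ℂ)‖ ^ 2 ≤ p Y ^ 2)
    (Rf : (Fin (constrCard (Bj M₁ Z k : DetSet (F.P K)) k) → lieSU (Fin N)) → PBond (F.P K) 0 → lieSU (Fin N))
    (hRf : ∀ v, fderiv ℝ (msChart F N K k (Bj M₁ Z k) (avgFamily (avOfRecord F N K) (1 : GaugeField (F.P K) 0 (SU N))) (1 : GaugeField (F.P K) 0 (SU N))) 0 (Rf v) = v)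
    {ρ : ℝ} (hρ : ∀ v, p (Rf v) ≤ ρ * qEta (Bj M₁ Z k) k v) {E : lieSU (Fin N)} (hE : E ≠ 0) : 1 ≤ 16 * (N : ℝ) * ρ ^ 2 :=
  letter_floor_fderiv_msChart_one_Bj_eta_numeral hk x hμν hx h₀ hμ hν p hp Rf hRf hρ hE

end Floor

end Summit.QuantumFields.YangMills.BalabanUVNodes.N12EtaSizeDefs
end
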